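import Mathlib
import HarnessLib

/-!
# Roundoff error for a fixed integration rule: Wilkinson's inner-product analysis
(Davis–Rabinowitz, *Methods of Numerical Integration*, 2nd ed. 1984, Sect. 4.2, (4.2.6)–(4.2.29))

## The text

Sect. 4.2 analyses the effect of roundoff in computing `∫_a^b f ≈ Σ_{k=1}^{n} w_k f(x_k)` (4.2.1) in `t`-digit
floating point with a single-precision accumulator, following Wilkinson. The machine operations satisfy
`fl(x₁ + x₂) = x₁(1 + ε') + x₂(1 + ε'')`, `fl(x₁ x₂) = x₁ x₂ (1 + ε''')` (4.2.2)–(4.2.5) with `|ε'|, |ε''| ≤ Ω₁`,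
`|ε'''| ≤ Ω₂` (4.2.9) (`Ω₁ = (3/2)2^{-t}`, `Ω₂ = 2^{-t}` binary; `(5.5)10^{-t}`, `½·10^{1-t}` decimal). The inner
product `s_n = fl(a₁b₁ + ⋯ + a_n b_n)` (4.2.6) is computed recursively, `t_r = fl(a_r b_r)`,
`s_r = fl(s_{r-1} + t_r)` (4.2.7), i.e. `t_r = a_r b_r (1 + ξ_r)`, `s_r = s_{r-1}(1 + η'_r) + t_r(1 + η''_r)` (4.2.8).
By recurrence `s_n = Σ a_r b_r (1 + ε_r)` (4.2.10) with `1 + ε_r = (1 + ξ_r)(1 + η''_r)(1 + η'_{r+1}) ⋯ (1 + η'_n)`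
(4.2.11), whence `(1 - Ω₂)(1 - Ω₁)^{n-r+1} ≤ 1 + ε_r ≤ (1 + Ω₂)(1 + Ω₁)^{n-r+1}` (4.2.12)–(4.2.13);
`(1 + Ω)^k ≤ 1 + kΩ (e^{kΩ} - 1)/(kΩ)` (4.2.14), `(1 - Ω)^k ≥ 1 - kΩ (e^{kΩ} - 1)/(kΩ)` (4.2.15); if `nΩ₁ ≤ 1/10`
(4.2.16) then, since `(e^{0.1} - 1)/0.1 ≤ 1.06`, `|ε_r| ≤ Ω₂ + (n - r + 1)Ω₁(1 + Ω₂)(1.06)` (4.2.17)–(4.2.18).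
Applied to `Σ w_i f(x_i)` with computed function values `f̄_i = f(x_i)(1 + θ_i)`, `|θ_i| ≤ θ` (4.2.20)–(4.2.21), the
total roundoff `R = Σ w_i f(x_i) - fl(Σ w_i f̄_i)` (4.2.22) satisfies (4.2.23)–(4.2.24)
`|R| ≤ θ Σ|w_i||f(x_i)| + (1 + θ) Σ |w_i||f(x_i)||ε_i|`, hence with `M = max |f|` (4.2.25) the bounds (4.2.26),
(4.2.27), and under `w_i ≥ 0`, `Σ w_i = b - a`, `w_i ≤ A/n` (4.2.28) the final estimate
`|R| ≤ θ(b - a)M + (1 + θ)MΩ₂(b - a) + 1.06(1 + θ)MΩ₁(1 + Ω₂)A(n + 1)/2` (4.2.29):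
roundoff grows at worst like the first power of `n`.

## What is formalised (the model is exact real arithmetic with bounded relative perturbations)

Indices are 0-based: the terms are `r = 0, …, n - 1`, the step `s_{r+1} = s_r(1 + η'_r) + t_r(1 + η''_r)` starts
from `s₀ = 0`, so DR84's `s₁ = t₁` is the case `η''₀ = 0` (and `η'₀` multiplies `s₀ = 0`); DR84's exponent
`n - r + 1` (1-based `r`) is our `n - r` (0-based `r`).
* `flInner` (4.2.6)–(4.2.8), `flFactor` = `1 + ε_r` (4.2.11), `flInner_eq_sum` (4.2.10), `flInner_sub_sum` (4.2.19)
  (DR84 prints (4.2.19) with the opposite sign of `ε_i`; only `|ε_i|` enters the bounds).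
* `flFactor_bounds` (4.2.12)–(4.2.13); `one_add_pow_le_exp_form` (4.2.14) and `one_sub_pow_ge_exp_form` (4.2.15)
  as displayed (their right/left-hand sides `1 ± kΩ (e^{kΩ} - 1)/(kΩ)` are `e^{kΩ}` and `2 - e^{kΩ}`; proved from
  `1 + x ≤ eˣ` and Bernoulli's inequality); `exp_sub_one_le_mul_of_le_tenth`: `0 ≤ x ≤ 1/10 ⇒ eˣ - 1 ≤ 1.06 x`
  (the numerical step behind (4.2.17)); `abs_flFactor_sub_one_le` (4.2.18) (its lower half uses Bernoulli
  directly, which is sharper than (4.2.15)).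
* `roundoffError` (4.2.22), `roundoffError_eq` (4.2.23), `abs_roundoffError_le` (4.2.24),
  `abs_roundoffError_le_of_abs_le` (4.2.26), `abs_roundoffError_le_of_small` (4.2.27),
  `abs_roundoffError_le_of_weights` (4.2.29).

Not formalised: the machine-arithmetic facts (4.2.2)–(4.2.5) themselves (they are the hypotheses `|ξ_r| ≤ Ω₂`,
`|η'_r|, |η''_r| ≤ Ω₁` here), Lapshin's statistical estimate, the interval-analysis remark.

## Engine use

Anchor M90 of the QUAD-3 lane (shared numerical engines serving client cells; rigour lives in the verifiers; every
published number belongs to a client cell's ledger, not to the engines group): the a-priori bound (4.2.27)/(4.2.29)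
is what a verifier cites when it accepts a floating-point quadrature sum with `n` nodes and tabulated weights as an
enclosure of the exact sum, before the truncation error of the rule is added (Sect. 4.3).

## References

* [DavisRabinowitz1984] P. J. Davis, P. Rabinowitz, *Methods of Numerical Integration*, 2nd ed., Academic Press
  1984, Sect. 4.2 "Roundoff Error for a Fixed Integration Rule", (4.2.6)–(4.2.29).
-/

namespace Literature.Analysis.Quadrature

open Finset Real

noncomputable section

/-! ### The floating-point model of an inner product, (4.2.6)–(4.2.11) -/

/-- (4.2.6)–(4.2.8): the machine value `s_n` of `t₀ + ⋯ + t_{n-1}`: `s₀ = 0`, `s_{r+1} = s_r (1 + η'_r) + t_r (1 + η''_r)`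
(the machine products `t_r = a_r b_r (1 + ξ_r)` are passed as `t`). [cite: DavisRabinowitz1984, Sect. 4.2 (4.2.6)-(4.2.8)] -/
def flInner (t η' η'' : ℕ → ℝ) : ℕ → ℝ
  | 0 => 0
  | r + 1 => flInner t η' η'' r * (1 + η' r) + t r * (1 + η'' r)

/-- (4.2.11): the accumulated factor `1 + ε_r = (1 + ξ_r)(1 + η''_r) ∏_{r<j<n} (1 + η'_j)` of the `r`-th term in `s_n`.
[cite: DavisRabinowitz1984, Sect. 4.2 (4.2.11)] -/
def flFactor (ξ η' η'' : ℕ → ℝ) (n r : ℕ) : ℝ :=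
  (1 + ξ r) * (1 + η'' r) * ∏ j ∈ Ico (r + 1) n, (1 + η' j)

/-- `s₀ = 0` (empty sum). [cite: DavisRabinowitz1984, Sect. 4.2 (4.2.7)] -/
@[simp] theorem flInner_zero (t η' η'' : ℕ → ℝ) : flInner t η' η'' 0 = 0 := rfl

/-- (4.2.7)–(4.2.8): the step `s_{r+1} = s_r (1 + η'_r) + t_r (1 + η''_r)`. [cite: DavisRabinowitz1984, Sect. 4.2 (4.2.7)-(4.2.8)] -/
theorem flInner_succ (t η' η'' : ℕ → ℝ) (r : ℕ) :
    flInner t η' η'' (r + 1) = flInner t η' η'' r * (1 + η' r) + t r * (1 + η'' r) := rfl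

/-- (4.2.10): `s_n = Σ_r a_r b_r (1 + ε_r)` with `1 + ε_r` as in (4.2.11).
[cite: DavisRabinowitz1984, Sect. 4.2 (4.2.10)-(4.2.11)] -/
theorem flInner_eq_sum (a b ξ η' η'' : ℕ → ℝ) (n : ℕ) :
    flInner (fun r => a r * b r * (1 + ξ r)) η' η'' n = ∑ r ∈ range n, a r * b r * flFactor ξ η' η'' n r := by
  induction n with
  | zero => simp
  | succ n ih =>
    rw [flInner_succ, ih, sum_range_succ, sum_mul]
    congr 1
    · refine sum_congr rfl fun r hr => ?_
      have hr' : r + 1 ≤ n := mem_range.mp hr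
      simp only [flFactor]
      rw [prod_Ico_succ_top hr']
      ring
    · simp [flFactor]
      ring

/-- (4.2.19): `fl(Σ aᵢbᵢ) - Σ aᵢbᵢ = Σ aᵢbᵢ εᵢ` (DR84 displays `Σ aᵢbᵢ - fl(Σ aᵢbᵢ) = Σ aᵢbᵢεᵢ`, i.e. the opposite
sign convention for `εᵢ`; only `|εᵢ|` is used afterwards). [cite: DavisRabinowitz1984, Sect. 4.2 (4.2.19)] -/
theorem flInner_sub_sum (a b ξ η' η'' : ℕ → ℝ) (n : ℕ) :
    flInner (fun r => a r * b r * (1 + ξ r)) η' η'' n - ∑ r ∈ range n, a r * b r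
      = ∑ r ∈ range n, a r * b r * (flFactor ξ η' η'' n r - 1) := by
  rw [flInner_eq_sum, ← sum_sub_distrib]
  refine sum_congr rfl fun r _ => by ring

/-! ### Bounds on the accumulated factors, (4.2.12)–(4.2.18) -/

/-- [folklore] a product of `card` factors each within `Ω ≤ 1` of `1` lies between `(1 - Ω)^card` and `(1 + Ω)^card`. -/
private theorem prod_one_add_bounds {η : ℕ → ℝ} {Ω : ℝ} (hη : ∀ j, |η j| ≤ Ω) (hΩ : Ω ≤ 1) (s : Finset ℕ) :
    (1 - Ω) ^ s.card ≤ ∏ j ∈ s, (1 + η j) ∧ ∏ j ∈ s, (1 + η j) ≤ (1 + Ω) ^ s.card := by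
  have hlo : ∀ j, 1 - Ω ≤ 1 + η j := fun j => by linarith [neg_abs_le (η j), hη j]
  have hhi : ∀ j, 1 + η j ≤ 1 + Ω := fun j => by linarith [le_abs_self (η j), hη j]
  constructor
  · rw [← prod_const]
    exact prod_le_prod (fun j _ => by linarith) fun j _ => hlo j
  · rw [← prod_const]
    exact prod_le_prod (fun j _ => le_trans (by linarith) (hlo j)) fun j _ => hhi j

/-- (4.2.12)–(4.2.13): under (4.2.9) (`|ξ_r| ≤ Ω₂`, `|η'_r|, |η''_r| ≤ Ω₁`, `Ω₁, Ω₂ ≤ 1`), for `r < n`,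
`(1 - Ω₂)(1 - Ω₁)^{n-r} ≤ 1 + ε_r ≤ (1 + Ω₂)(1 + Ω₁)^{n-r}` (0-based `r`; DR84's exponent `n - r + 1` for 1-based `r`).
[cite: DavisRabinowitz1984, Sect. 4.2 (4.2.12)-(4.2.13)] -/
theorem flFactor_bounds {ξ η' η'' : ℕ → ℝ} {Ω₁ Ω₂ : ℝ} (hξ : ∀ r, |ξ r| ≤ Ω₂) (hη' : ∀ r, |η' r| ≤ Ω₁)
    (hη'' : ∀ r, |η'' r| ≤ Ω₁) (hΩ₁ : Ω₁ ≤ 1) (hΩ₂ : Ω₂ ≤ 1) {n r : ℕ} (hr : r < n) :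
    (1 - Ω₂) * (1 - Ω₁) ^ (n - r) ≤ flFactor ξ η' η'' n r
      ∧ flFactor ξ η' η'' n r ≤ (1 + Ω₂) * (1 + Ω₁) ^ (n - r) := by
  obtain ⟨plo, phi⟩ := prod_one_add_bounds hη' hΩ₁ (Ico (r + 1) n)
  rw [Nat.card_Ico] at plo phi
  have hm : n - r = (n - (r + 1)) + 1 := by omega
  have hξlo : 1 - Ω₂ ≤ 1 + ξ r := by linarith [neg_abs_le (ξ r), hξ r]
  have hξhi : 1 + ξ r ≤ 1 + Ω₂ := by linarith [le_abs_self (ξ r), hξ r]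
  have hηlo : 1 - Ω₁ ≤ 1 + η'' r := by linarith [neg_abs_le (η'' r), hη'' r]
  have hηhi : 1 + η'' r ≤ 1 + Ω₁ := by linarith [le_abs_self (η'' r), hη'' r]
  have h0Ω₁ : 0 ≤ 1 - Ω₁ := by linarith
  have h0Ω₂ : 0 ≤ 1 - Ω₂ := by linarith
  have hP0 : 0 ≤ (1 - Ω₁) ^ (n - (r + 1)) := pow_nonneg h0Ω₁ _
  rw [hm, pow_succ, flFactor]
  constructor
  · calc (1 - Ω₂) * ((1 - Ω₁) ^ (n - (r + 1)) * (1 - Ω₁))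
        = (1 - Ω₂) * (1 - Ω₁) * (1 - Ω₁) ^ (n - (r + 1)) := by ring
      _ ≤ (1 + ξ r) * (1 + η'' r) * ∏ j ∈ Ico (r + 1) n, (1 + η' j) := by
        apply mul_le_mul (mul_le_mul hξlo hηlo h0Ω₁ (le_trans h0Ω₂ hξlo)) plo hP0
        exact mul_nonneg (le_trans h0Ω₂ hξlo) (le_trans h0Ω₁ hηlo)
  · calc (1 + ξ r) * (1 + η'' r) * ∏ j ∈ Ico (r + 1) n, (1 + η' j)
        ≤ (1 + Ω₂) * (1 + Ω₁) * (1 + Ω₁) ^ (n - (r + 1)) := by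
          apply mul_le_mul (mul_le_mul hξhi hηhi (le_trans h0Ω₁ hηlo) (by linarith [le_trans h0Ω₂ hξlo]))
            phi (le_trans hP0 plo)
          exact mul_nonneg (by linarith [le_trans h0Ω₂ hξlo]) (by linarith [le_trans h0Ω₁ hηlo])
      _ = (1 + Ω₂) * ((1 + Ω₁) ^ (n - (r + 1)) * (1 + Ω₁)) := by ring

/-- [folklore] `(1 + Ω)^k ≤ e^{kΩ}` for `Ω ≥ -1` (the content of (4.2.14); in the tree many times for `Ω ≥ 0`). -/
private theorem one_add_pow_le_exp_mul {Ω : ℝ} (hΩ : -1 ≤ Ω) (k : ℕ) : (1 + Ω) ^ k ≤ exp (k * Ω) := by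
  rw [Real.exp_nat_mul]
  exact pow_le_pow_left₀ (by linarith) (by linarith [add_one_le_exp Ω]) k

/-- (4.2.14): `(1 + Ω)^k ≤ 1 + kΩ·((e^{kΩ} - 1)/(kΩ))` (the right-hand side is `e^{kΩ}`; `Ω ≥ -1`; for `kΩ = 0`
both sides are `1`). [cite: DavisRabinowitz1984, Sect. 4.2 (4.2.14)] -/
theorem one_add_pow_le_exp_form {Ω : ℝ} (hΩ : -1 ≤ Ω) (k : ℕ) :
    (1 + Ω) ^ k ≤ 1 + k * Ω * ((exp (k * Ω) - 1) / (k * Ω)) := by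
  by_cases h : (k : ℝ) * Ω = 0
  · rcases mul_eq_zero.mp h with hk | hΩ0
    · have : k = 0 := by exact_mod_cast hk
      simp [this]
    · simp [hΩ0]
  · rw [mul_div_cancel₀ _ h]
    linarith [one_add_pow_le_exp_mul hΩ k]

/-- [folklore] `2 - e^{kΩ} ≤ (1 - Ω)^k` for `Ω ≤ 2` (the content of (4.2.15): Bernoulli's inequality
`(1 - Ω)^k ≥ 1 - kΩ` and `e^{kΩ} ≥ 1 + kΩ`). -/
private theorem sub_exp_mul_le_one_sub_pow {Ω : ℝ} (hΩ : Ω ≤ 2) (k : ℕ) : 2 - exp (k * Ω) ≤ (1 - Ω) ^ k := by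
  have hB : 1 + (k : ℝ) * (-Ω) ≤ (1 + -Ω) ^ k := one_add_mul_le_pow (by linarith) k
  have hE : (k : ℝ) * Ω + 1 ≤ exp (k * Ω) := add_one_le_exp _
  calc 2 - exp (k * Ω) ≤ 1 + k * -Ω := by linarith
    _ ≤ (1 + -Ω) ^ k := hB
    _ = (1 - Ω) ^ k := by rw [← sub_eq_add_neg]

/-- (4.2.15): `1 - kΩ·((e^{kΩ} - 1)/(kΩ)) ≤ (1 - Ω)^k` (the left-hand side is `2 - e^{kΩ}`; `Ω ≤ 2`).
[cite: DavisRabinowitz1984, Sect. 4.2 (4.2.15)] -/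
theorem one_sub_pow_ge_exp_form {Ω : ℝ} (hΩ : Ω ≤ 2) (k : ℕ) :
    1 - k * Ω * ((exp (k * Ω) - 1) / (k * Ω)) ≤ (1 - Ω) ^ k := by
  by_cases h : (k : ℝ) * Ω = 0
  · rcases mul_eq_zero.mp h with hk | hΩ0
    · have : k = 0 := by exact_mod_cast hk
      simp [this]
    · simp [hΩ0]
  · rw [mul_div_cancel₀ _ h]
    linarith [sub_exp_mul_le_one_sub_pow hΩ k]

/-- The numerical step of (4.2.16)–(4.2.17): for `0 ≤ x ≤ 1/10`, `e^x - 1 ≤ 1.06·x`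
(DR84: "since `(e^{.1} - 1)/.1 ≤ 1.06`"). [cite: DavisRabinowitz1984, Sect. 4.2 (4.2.16)-(4.2.17)] -/
theorem exp_sub_one_le_mul_of_le_tenth {x : ℝ} (hx0 : 0 ≤ x) (hx : x ≤ 1 / 10) :
    exp x - 1 ≤ 1.06 * x := by
  have h := Real.exp_bound' hx0 (by linarith) (n := 3) (by norm_num)
  simp only [sum_range_succ, sum_range_zero, Nat.factorial, Nat.succ_eq_add_one, Nat.cast_ofNat,
    pow_zero, pow_one, zero_add, mul_one] at h
  norm_num at h
  nlinarith [mul_nonneg hx0 (sub_nonneg.2 hx), mul_nonneg (mul_self_nonneg x) (sub_nonneg.2 hx)]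

/-- (4.2.17)–(4.2.18): under (4.2.9) with `Ω₁, Ω₂ ≤ 1` and `nΩ₁ ≤ 1/10` (4.2.16), for `r < n`,
`|ε_r| ≤ Ω₂ + (n - r)Ω₁(1 + Ω₂)(1.06)` (0-based `r`). [cite: DavisRabinowitz1984, Sect. 4.2 (4.2.17)-(4.2.18)] -/
theorem abs_flFactor_sub_one_le {ξ η' η'' : ℕ → ℝ} {Ω₁ Ω₂ : ℝ} (hξ : ∀ r, |ξ r| ≤ Ω₂) (hη' : ∀ r, |η' r| ≤ Ω₁)
    (hη'' : ∀ r, |η'' r| ≤ Ω₁) (hΩ₁ : Ω₁ ≤ 1) (hΩ₂ : Ω₂ ≤ 1) {n r : ℕ} (hr : r < n) (hn : n * Ω₁ ≤ 1 / 10) :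
    |flFactor ξ η' η'' n r - 1| ≤ Ω₂ + (n - r : ℕ) * Ω₁ * (1 + Ω₂) * 1.06 := by
  obtain ⟨hlo, hhi⟩ := flFactor_bounds hξ hη' hη'' hΩ₁ hΩ₂ hr
  have hΩ₁0 : 0 ≤ Ω₁ := le_trans (abs_nonneg _) (hη' 0)
  have hΩ₂0 : 0 ≤ Ω₂ := le_trans (abs_nonneg _) (hξ 0)
  set m : ℕ := n - r with hm
  have hmn : (m : ℝ) ≤ n := by exact_mod_cast Nat.sub_le n r
  have hmΩ0 : 0 ≤ (m : ℝ) * Ω₁ := mul_nonneg (Nat.cast_nonneg _) hΩ₁0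
  have hmΩ : (m : ℝ) * Ω₁ ≤ 1 / 10 := le_trans (mul_le_mul_of_nonneg_right hmn hΩ₁0) hn
  -- upper side via (4.2.14) and the numerical step
  have hup : (1 + Ω₁) ^ m ≤ 1 + 1.06 * (m * Ω₁) := by
    have h1 := one_add_pow_le_exp_mul (by linarith : (-1 : ℝ) ≤ Ω₁) m
    have h2 := exp_sub_one_le_mul_of_le_tenth hmΩ0 hmΩ
    linarith
  -- lower side via Bernoulli
  have hdown : 1 - (m : ℝ) * Ω₁ ≤ (1 - Ω₁) ^ m := by
    have hB : 1 + (m : ℝ) * (-Ω₁) ≤ (1 + -Ω₁) ^ m := one_add_mul_le_pow (by linarith) m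
    calc 1 - (m : ℝ) * Ω₁ = 1 + m * -Ω₁ := by ring
      _ ≤ (1 + -Ω₁) ^ m := hB
      _ = (1 - Ω₁) ^ m := by rw [← sub_eq_add_neg]
  rw [abs_le]
  constructor
  · have : (1 - Ω₂) * (1 - (m : ℝ) * Ω₁) ≤ flFactor ξ η' η'' n r :=
      le_trans (mul_le_mul_of_nonneg_left hdown (by linarith)) hlo
    nlinarith [mul_nonneg hmΩ0 hΩ₂0]
  · have : flFactor ξ η' η'' n r ≤ (1 + Ω₂) * (1 + 1.06 * (m * Ω₁)) :=
      le_trans hhi (mul_le_mul_of_nonneg_left hup (by linarith))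
    nlinarith

/-! ### Application to an integration rule, (4.2.20)–(4.2.29) -/

/-- (4.2.22): the total roundoff `R = Σ wᵢ f(xᵢ) - fl(Σ wᵢ f̄ᵢ)` of the rule `Σ wᵢ f(xᵢ)` evaluated in floating point from
the computed function values `f̄ᵢ = f(xᵢ)(1 + θᵢ)` (4.2.20) (`fx i = f(xᵢ)`; `ξ, η', η''` the machine perturbations of
(4.2.8)). [cite: DavisRabinowitz1984, Sect. 4.2 (4.2.20)-(4.2.22)] -/
def roundoffError (w fx θ ξ η' η'' : ℕ → ℝ) (n : ℕ) : ℝ :=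
  ∑ i ∈ range n, w i * fx i - flInner (fun i => w i * (fx i * (1 + θ i)) * (1 + ξ i)) η' η'' n

/-- (4.2.23): `R = Σ wᵢ f(xᵢ) - Σ wᵢ f̄ᵢ - Σ wᵢ f̄ᵢ εᵢ` (DR84's last sign is `+` with its opposite convention for `εᵢ`).
[cite: DavisRabinowitz1984, Sect. 4.2 (4.2.23)] -/
theorem roundoffError_eq (w fx θ ξ η' η'' : ℕ → ℝ) (n : ℕ) :
    roundoffError w fx θ ξ η' η'' n
      = ∑ i ∈ range n, w i * fx i - ∑ i ∈ range n, w i * (fx i * (1 + θ i))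
          - ∑ i ∈ range n, w i * (fx i * (1 + θ i)) * (flFactor ξ η' η'' n i - 1) := by
  rw [roundoffError, flInner_eq_sum, sub_sub, ← sum_add_distrib]
  congr 1
  exact sum_congr rfl fun i _ => by ring

/-- (4.2.24): `|R| ≤ θ Σ |wᵢ||f(xᵢ)| + (1 + θ) Σ |wᵢ||f(xᵢ)||εᵢ|` when `|θᵢ| ≤ θ` (4.2.21).
[cite: DavisRabinowitz1984, Sect. 4.2 (4.2.24)] -/
theorem abs_roundoffError_le {w fx θ ξ η' η'' : ℕ → ℝ} {Θ : ℝ} (hθ : ∀ i, |θ i| ≤ Θ) (n : ℕ) :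
    |roundoffError w fx θ ξ η' η'' n|
      ≤ Θ * ∑ i ∈ range n, |w i| * |fx i|
        + (1 + Θ) * ∑ i ∈ range n, |w i| * |fx i| * |flFactor ξ η' η'' n i - 1| := by
  have hR : roundoffError w fx θ ξ η' η'' n
      = ∑ i ∈ range n, (-(w i * fx i * θ i) - w i * fx i * (1 + θ i) * (flFactor ξ η' η'' n i - 1)) := by
    rw [roundoffError_eq, ← sum_sub_distrib, ← sum_sub_distrib]
    exact sum_congr rfl fun i _ => by ring
  rw [hR, mul_sum, mul_sum, ← sum_add_distrib]
  refine le_trans (abs_sum_le_sum_abs _ _) (sum_le_sum fun i _ => ?_)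
  have h1 : |-(w i * fx i * θ i)| ≤ Θ * (|w i| * |fx i|) := by
    rw [abs_neg, abs_mul, abs_mul]
    calc |w i| * |fx i| * |θ i| ≤ |w i| * |fx i| * Θ :=
          mul_le_mul_of_nonneg_left (hθ i) (mul_nonneg (abs_nonneg _) (abs_nonneg _))
      _ = Θ * (|w i| * |fx i|) := by ring
  have h2 : |w i * fx i * (1 + θ i) * (flFactor ξ η' η'' n i - 1)|
      ≤ (1 + Θ) * (|w i| * |fx i| * |flFactor ξ η' η'' n i - 1|) := by
    rw [abs_mul, abs_mul, abs_mul]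
    have h1θ : |1 + θ i| ≤ 1 + Θ := by
      calc |1 + θ i| ≤ |(1 : ℝ)| + |θ i| := abs_add_le _ _
        _ = 1 + |θ i| := by rw [abs_one]
        _ ≤ 1 + Θ := by linarith [hθ i]
    calc |w i| * |fx i| * |1 + θ i| * |flFactor ξ η' η'' n i - 1|
        = |1 + θ i| * (|w i| * |fx i| * |flFactor ξ η' η'' n i - 1|) := by ring
      _ ≤ (1 + Θ) * (|w i| * |fx i| * |flFactor ξ η' η'' n i - 1|) :=
          mul_le_mul_of_nonneg_right h1θ (by positivity)
  calc |-(w i * fx i * θ i) - w i * fx i * (1 + θ i) * (flFactor ξ η' η'' n i - 1)|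
      ≤ |-(w i * fx i * θ i)| + |w i * fx i * (1 + θ i) * (flFactor ξ η' η'' n i - 1)| := abs_sub _ _
    _ ≤ _ := add_le_add h1 h2

/-- (4.2.25)–(4.2.26): with `M ≥ |f(xᵢ)|` for all `i`, `|R| ≤ θ M Σ|wᵢ| + (1 + θ) M Σ |wᵢ||εᵢ|`.
[cite: DavisRabinowitz1984, Sect. 4.2 (4.2.25)-(4.2.26)] -/
theorem abs_roundoffError_le_of_abs_le {w fx θ ξ η' η'' : ℕ → ℝ} {Θ M : ℝ} (hθ : ∀ i, |θ i| ≤ Θ)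
    (hΘ : 0 ≤ Θ) (hM : ∀ i, |fx i| ≤ M) (n : ℕ) :
    |roundoffError w fx θ ξ η' η'' n|
      ≤ Θ * M * ∑ i ∈ range n, |w i| + (1 + Θ) * M * ∑ i ∈ range n, |w i| * |flFactor ξ η' η'' n i - 1| := by
  refine le_trans (abs_roundoffError_le hθ n) (add_le_add ?_ ?_)
  · calc Θ * ∑ i ∈ range n, |w i| * |fx i| ≤ Θ * ∑ i ∈ range n, |w i| * M :=
          mul_le_mul_of_nonneg_left
            (sum_le_sum fun i _ => mul_le_mul_of_nonneg_left (hM i) (abs_nonneg _)) hΘ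
      _ = Θ * M * ∑ i ∈ range n, |w i| := by rw [← sum_mul]; ring
  · calc (1 + Θ) * ∑ i ∈ range n, |w i| * |fx i| * |flFactor ξ η' η'' n i - 1|
        ≤ (1 + Θ) * ∑ i ∈ range n, M * (|w i| * |flFactor ξ η' η'' n i - 1|) := by
          refine mul_le_mul_of_nonneg_left (sum_le_sum fun i _ => ?_) (by linarith)
          calc |w i| * |fx i| * |flFactor ξ η' η'' n i - 1| ≤ |w i| * M * |flFactor ξ η' η'' n i - 1| :=
                mul_le_mul_of_nonneg_right (mul_le_mul_of_nonneg_left (hM i) (abs_nonneg _)) (abs_nonneg _)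
            _ = M * (|w i| * |flFactor ξ η' η'' n i - 1|) := by ring
      _ = (1 + Θ) * M * ∑ i ∈ range n, |w i| * |flFactor ξ η' η'' n i - 1| := by rw [← mul_sum]; ring

/-- (4.2.27): inserting (4.2.18) (machine constants `Ω₁, Ω₂ ≤ 1` of (4.2.9), `nΩ₁ ≤ 1/10`):
`|R| ≤ θMΣ|wᵢ| + (1 + θ)MΩ₂Σ|wᵢ| + 1.06(1 + θ)MΩ₁(1 + Ω₂) Σᵢ |wᵢ|(n - i)` (0-based `i`; DR84's `n - i + 1`).
[cite: DavisRabinowitz1984, Sect. 4.2 (4.2.27)] -/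
theorem abs_roundoffError_le_of_small {w fx θ ξ η' η'' : ℕ → ℝ} {Θ M Ω₁ Ω₂ : ℝ} (hθ : ∀ i, |θ i| ≤ Θ)
    (hΘ : 0 ≤ Θ) (hM : ∀ i, |fx i| ≤ M) (hξ : ∀ r, |ξ r| ≤ Ω₂) (hη' : ∀ r, |η' r| ≤ Ω₁)
    (hη'' : ∀ r, |η'' r| ≤ Ω₁) (hΩ₁ : Ω₁ ≤ 1) (hΩ₂ : Ω₂ ≤ 1) {n : ℕ} (hn : n * Ω₁ ≤ 1 / 10) :
    |roundoffError w fx θ ξ η' η'' n|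
      ≤ Θ * M * ∑ i ∈ range n, |w i| + (1 + Θ) * M * Ω₂ * ∑ i ∈ range n, |w i|
        + 1.06 * (1 + Θ) * M * Ω₁ * (1 + Ω₂) * ∑ i ∈ range n, |w i| * ((n - i : ℕ) : ℝ) := by
  have hM0 : 0 ≤ M := le_trans (abs_nonneg _) (hM 0)
  refine le_trans (abs_roundoffError_le_of_abs_le hθ hΘ hM n) ?_
  have key : ∑ i ∈ range n, |w i| * |flFactor ξ η' η'' n i - 1|
      ≤ Ω₂ * ∑ i ∈ range n, |w i| + Ω₁ * (1 + Ω₂) * 1.06 * ∑ i ∈ range n, |w i| * ((n - i : ℕ) : ℝ) := by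
    rw [mul_sum, mul_sum, ← sum_add_distrib]
    refine sum_le_sum fun i hi => ?_
    have hb := abs_flFactor_sub_one_le hξ hη' hη'' hΩ₁ hΩ₂ (mem_range.mp hi) hn
    calc |w i| * |flFactor ξ η' η'' n i - 1| ≤ |w i| * (Ω₂ + ((n - i : ℕ) : ℝ) * Ω₁ * (1 + Ω₂) * 1.06) :=
          mul_le_mul_of_nonneg_left hb (abs_nonneg _)
      _ = Ω₂ * |w i| + Ω₁ * (1 + Ω₂) * 1.06 * (|w i| * ((n - i : ℕ) : ℝ)) := by ring
  have h1Θ : 0 ≤ (1 + Θ) * M := mul_nonneg (by linarith) hM0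
  calc Θ * M * ∑ i ∈ range n, |w i| + (1 + Θ) * M * ∑ i ∈ range n, |w i| * |flFactor ξ η' η'' n i - 1|
      ≤ Θ * M * ∑ i ∈ range n, |w i| + (1 + Θ) * M * (Ω₂ * ∑ i ∈ range n, |w i|
          + Ω₁ * (1 + Ω₂) * 1.06 * ∑ i ∈ range n, |w i| * ((n - i : ℕ) : ℝ)) :=
        add_le_add le_rfl (mul_le_mul_of_nonneg_left key h1Θ)
    _ = _ := by ring

/-- [folklore] `Σ_{i<n} (n - i) = n(n + 1)/2`. -/
private theorem sum_range_cast_sub (n : ℕ) : ∑ i ∈ range n, ((n - i : ℕ) : ℝ) = n * (n + 1) / 2 := by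
  have h : ∀ m : ℕ, ∑ i ∈ range m, (i : ℝ) = m * (m - 1) / 2 := by
    intro m
    induction m with
    | zero => simp
    | succ m ih => rw [sum_range_succ, ih]; push_cast; ring
  have : ∑ i ∈ range n, ((n - i : ℕ) : ℝ) = ∑ i ∈ range n, ((n : ℝ) - i) :=
    sum_congr rfl fun i hi => by rw [Nat.cast_sub (mem_range.mp hi).le]
  rw [this, sum_sub_distrib, sum_const, card_range, h n, nsmul_eq_mul]
  ring

/-- (4.2.28)–(4.2.29), the final estimate: if moreover `wᵢ ≥ 0`, `Σ wᵢ = b - a` and `wᵢ ≤ A/n` (`n ≥ 1`), then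
`|R| ≤ θ(b - a)M + (1 + θ)MΩ₂(b - a) + 1.06(1 + θ)MΩ₁(1 + Ω₂)A(n + 1)/2` — roundoff grows at worst like the first
power of `n`. [cite: DavisRabinowitz1984, Sect. 4.2 (4.2.28)-(4.2.29)] -/
theorem abs_roundoffError_le_of_weights {w fx θ ξ η' η'' : ℕ → ℝ} {Θ M Ω₁ Ω₂ A L : ℝ} (hθ : ∀ i, |θ i| ≤ Θ)
    (hΘ : 0 ≤ Θ) (hM : ∀ i, |fx i| ≤ M) (hξ : ∀ r, |ξ r| ≤ Ω₂) (hη' : ∀ r, |η' r| ≤ Ω₁)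
    (hη'' : ∀ r, |η'' r| ≤ Ω₁) (hΩ₁ : Ω₁ ≤ 1) (hΩ₂ : Ω₂ ≤ 1) {n : ℕ} (hn0 : 0 < n) (hn : n * Ω₁ ≤ 1 / 10)
    (hw0 : ∀ i, 0 ≤ w i) (hwL : ∑ i ∈ range n, w i = L) (hwA : ∀ i, w i ≤ A / n) :
    |roundoffError w fx θ ξ η' η'' n|
      ≤ Θ * L * M + (1 + Θ) * M * Ω₂ * L + 1.06 * (1 + Θ) * M * Ω₁ * (1 + Ω₂) * A * ((n + 1) / 2) := by
  have hM0 : 0 ≤ M := le_trans (abs_nonneg _) (hM 0)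
  have hΩ₁0 : 0 ≤ Ω₁ := le_trans (abs_nonneg _) (hη' 0)
  have hΩ₂0 : 0 ≤ Ω₂ := le_trans (abs_nonneg _) (hξ 0)
  have habs : ∑ i ∈ range n, |w i| = L := by
    rw [← hwL]; exact sum_congr rfl fun i _ => abs_of_nonneg (hw0 i)
  have hnpos : (0 : ℝ) < n := by exact_mod_cast hn0
  have hsum : ∑ i ∈ range n, |w i| * ((n - i : ℕ) : ℝ) ≤ A * ((n + 1) / 2) := by
    calc ∑ i ∈ range n, |w i| * ((n - i : ℕ) : ℝ) ≤ ∑ i ∈ range n, A / n * ((n - i : ℕ) : ℝ) :=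
          sum_le_sum fun i _ => mul_le_mul_of_nonneg_right (by rw [abs_of_nonneg (hw0 i)]; exact hwA i)
            (Nat.cast_nonneg _)
      _ = A / n * (n * (n + 1) / 2) := by rw [← mul_sum, sum_range_cast_sub]
      _ = A * ((n + 1) / 2) := by field_simp
  have hc : 0 ≤ 1.06 * (1 + Θ) * M * Ω₁ * (1 + Ω₂) := by
    have : 0 ≤ (1 + Θ) * M := mul_nonneg (by linarith) hM0
    positivity
  calc |roundoffError w fx θ ξ η' η'' n|
      ≤ Θ * M * ∑ i ∈ range n, |w i| + (1 + Θ) * M * Ω₂ * ∑ i ∈ range n, |w i|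
        + 1.06 * (1 + Θ) * M * Ω₁ * (1 + Ω₂) * ∑ i ∈ range n, |w i| * ((n - i : ℕ) : ℝ) :=
        abs_roundoffError_le_of_small hθ hΘ hM hξ hη' hη'' hΩ₁ hΩ₂ hn
    _ ≤ Θ * M * L + (1 + Θ) * M * Ω₂ * L + 1.06 * (1 + Θ) * M * Ω₁ * (1 + Ω₂) * (A * ((n + 1) / 2)) := by
        rw [habs]; exact add_le_add le_rfl (mul_le_mul_of_nonneg_left hsum hc)
    _ = _ := by ring

end

end Literature.Analysis.Quadrature
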